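import Summits.Ventures.PercRepro.CoreCountA
import Summits.Ventures.PercRepro.RankLevelSetH
import Summits.Ventures.PercRepro.RankLevelSetCountBounds

/-!
# PercRepro — counting on the core, part B: the rank-`≤ 3` sets, and the `Set.ncard` bridges to `C025` (p2, gen 11)

The second half of NIGHT-1 §12's COUNTS ON THE CORE: `R₃ = #{r ≤ 3} ≤ Σ_{j≤3} C(n,j) + (1 + ρ)·C(n,3)` (a set of
rank `≤ 3` has `≤ 3` points or is a rank-`3` set with `≥ 4` points, i.e. a «triple + point» or a cyclic set — part A),
and the bridges from the set-builders of `C025` (`Set.ncard` of families of subsets of `M.E`) to the finset counts: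
`#U(p,3) ≤ W₃` (`A ↦ E ∖ A`), `#{r ≤ 3}` as a finset count, and the two lower bounds on `#Y(p,3)` used by the two
regimes — `2ⁿ ≤ #Y + #{r ≤ 3} + #{spanning}` (every subset of `E` has rank `≤ 3`, in `(3, p)`, or `= p = r(E)`) and
`Σ_{u=4}^{p−1} C(n,u) ≤ #Y + #{r ≤ 3}` (a set with `4 ≤ |A| ≤ p − 1` has rank `< p`).

* `rankLe3` — the rank-`≤ 3` subsets of the ground set; `thirtyfive_mul_card_rankLe3_le` — `35·R₃ ≤ 35·Σ_{j<4} C(n,j) + 99·C(n,3)`;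
* `ncard_U_le_card_rank3Sets` — `#U(p,3) ≤ W₃`; `ncard_rankLe3_eq` — `#{r ≤ 3} = #rankLe3`;
* `two_pow_le_ncard_Y_add` — `2ⁿ ≤ #Y + #{r ≤ 3} + #{spanning}` when `r(E) = p`;
* `sum_choose_le_ncard_Y_add` — `Σ_{u∈[4,p)} C(n,u) ≤ #Y + #{r ≤ 3}`.
Imports `CoreCountA`, `RankLevelSetH` (`ncard_family_eq_card`) and `RankLevelSetCountBounds`. Axioms: standard.
-/

namespace PercRepro
namespace CoreCount

open Finset ThmH RhoLemma

variable {α : Type*} [DecidableEq α] {M : Matroid α} [M.Finite]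

open scoped Classical in
/-- The rank-`≤ 3` subsets of the ground set (`R₃`). -/
noncomputable def rankLe3 (M : Matroid α) [M.Finite] : Finset (Finset α) :=
  (gr M).powerset.filter (fun (S : Finset α) => M.eRk (S : Set α) ≤ 3)

open scoped Classical in
/-- The subsets of a finset with at most `3` elements number `Σ_{j<4} C(g, j)`. -/
theorem card_filter_card_le_three (G : Finset α) :
    (G.powerset.filter (fun (S : Finset α) => S.card ≤ 3)).card = ∑ j ∈ range 4, Nat.choose G.card j := by
  have hsmall : G.powerset.filter (fun (S : Finset α) => S.card ≤ 3) = (range 4).biUnion (fun j => powersetCard j G) := by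
    ext S
    simp only [Finset.mem_filter, Finset.mem_powerset, Finset.mem_biUnion, Finset.mem_range,
      Finset.mem_powersetCard]
    constructor
    · rintro ⟨hS, hc⟩
      exact ⟨S.card, by omega, hS, rfl⟩
    · rintro ⟨j, hj, hS, rfl⟩
      exact ⟨hS, by omega⟩
  rw [hsmall, Finset.card_biUnion]
  · apply Finset.sum_congr rfl
    intro j _
    exact Finset.card_powersetCard j G
  · intro i _ j _ hij
    exact Finset.pairwise_disjoint_powersetCard G hij

open scoped Classical in
/-- **`35·R₃ ≤ 35·Σ_{j<4} C(n,j) + 99·C(n,3)`**: a set of rank `≤ 3` has `≤ 3` points, or is a «rank-`2` triple +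
point», or is a cyclic rank-`3` set. -/
theorem thirtyfive_mul_card_rankLe3_le (hs : Simple M)
    (hC1 : ∀ L ⊆ gr M, M.eRk (L : Set α) = 2 → L.card ≤ 3)
    (hC2 : ∀ P ⊆ gr M, M.eRk (P : Set α) = 3 → P.card ≤ 7) :
    35 * (rankLe3 M).card ≤ 35 * (∑ j ∈ range 4, Nat.choose (gr M).card j) + 99 * Nat.choose (gr M).card 3 := by
  have hsub : rankLe3 M ⊆ (gr M).powerset.filter (fun (S : Finset α) => S.card ≤ 3) ∪ linePoint M ∪ cyclic3 M := by
    intro S hS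
    unfold rankLe3 at hS
    rw [Finset.mem_filter, Finset.mem_powerset] at hS
    obtain ⟨hSG, hr⟩ := hS
    rw [Finset.mem_union, Finset.mem_union]
    rcases Nat.lt_or_ge S.card 4 with hlt | h4
    · left; left
      rw [Finset.mem_filter, Finset.mem_powerset]
      exact ⟨hSG, by omega⟩
    · have h3 : M.eRk (S : Set α) = 3 := le_antisymm hr (three_le_eRk_of_four_le hs hC1 hSG h4)
      have hmem : S ∈ rank3Sets M := by
        unfold rank3Sets
        rw [Finset.mem_filter, Finset.mem_powerset]
        exact ⟨hSG, h3⟩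
      have h := rank3Sets_subset hs hC1 hmem
      rw [Finset.mem_union, Finset.mem_union] at h
      rcases h with (h | h) | h
      · left; left
        unfold rank3Triples at h
        rw [Finset.mem_filter, Finset.mem_powerset] at h
        rw [Finset.mem_filter, Finset.mem_powerset]
        exact ⟨h.1, by omega⟩
      · left; right; exact h
      · right; exact h
  have h1 : (rankLe3 M).card ≤ (∑ j ∈ range 4, Nat.choose (gr M).card j) + (linePoint M).card + (cyclic3 M).card := by
    calc (rankLe3 M).card ≤ ((gr M).powerset.filter (fun (S : Finset α) => S.card ≤ 3) ∪ linePoint M ∪ cyclic3 M).card :=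
          Finset.card_le_card hsub
      _ ≤ ((gr M).powerset.filter (fun (S : Finset α) => S.card ≤ 3) ∪ linePoint M).card + (cyclic3 M).card :=
          Finset.card_union_le _ _
      _ ≤ ((gr M).powerset.filter (fun (S : Finset α) => S.card ≤ 3)).card + (linePoint M).card + (cyclic3 M).card := by
          gcongr; exact Finset.card_union_le _ _
      _ = (∑ j ∈ range 4, Nat.choose (gr M).card j) + (linePoint M).card + (cyclic3 M).card := by
          rw [card_filter_card_le_three]
  have h2 := card_linePoint_le hs hC1
  have h3 := thirtyfive_mul_card_cyclic3_le hs hC1 hC2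
  have h4 := card_rank3Triples_le (M := M)
  omega

/-! ### The `Set.ncard` bridges -/

omit [DecidableEq α] in
/-- The finite family of all subsets of the ground set. -/
theorem finite_subsets_ground (M : Matroid α) [M.Finite] (P : Set α → Prop) :
    {S : Set α | S ⊆ M.E ∧ P S}.Finite :=
  M.ground_finite.powerset.subset (fun _ hS => hS.1)

omit [DecidableEq α] in
/-- **`#U(p,3) ≤ W₃`**: `A ↦ E ∖ A` maps `U(p,3)` injectively into the rank-`3` sets. -/
theorem ncard_U_le_card_rank3Sets (M : Matroid α) [M.Finite] (p : ℕ) :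
    {A : Set α | A ⊆ M.E ∧ M.eRk A = (p : ℕ∞) ∧ M.eRk (M.E \ A) = ((3 : ℕ) : ℕ∞)}.ncard ≤ (rank3Sets M).card := by
  classical
  have hmaps : ∀ A ∈ {A : Set α | A ⊆ M.E ∧ M.eRk A = (p : ℕ∞) ∧ M.eRk (M.E \ A) = ((3 : ℕ) : ℕ∞)},
      (fun A : Set α => M.E \ A) A ∈ {B : Set α | B ⊆ M.E ∧ M.eRk B = 3} := by
    intro A hA
    refine ⟨Set.sdiff_subset, ?_⟩
    have := hA.2.2
    simpa using this
  have hinj : Set.InjOn (fun A : Set α => M.E \ A)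
      {A : Set α | A ⊆ M.E ∧ M.eRk A = (p : ℕ∞) ∧ M.eRk (M.E \ A) = ((3 : ℕ) : ℕ∞)} := by
    intro X hX Y hY hXY
    simp only at hXY
    rw [← Set.sdiff_sdiff_cancel_left hX.1, hXY, Set.sdiff_sdiff_cancel_left hY.1]
  calc {A : Set α | A ⊆ M.E ∧ M.eRk A = (p : ℕ∞) ∧ M.eRk (M.E \ A) = ((3 : ℕ) : ℕ∞)}.ncard
      ≤ {B : Set α | B ⊆ M.E ∧ M.eRk B = 3}.ncard :=
        Set.ncard_le_ncard_of_injOn _ hmaps hinj (finite_subsets_ground M _)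
    _ = (rank3Sets M).card := by
        rw [ncard_family_eq_card M (fun B => M.eRk B = 3)]
        rfl

omit [DecidableEq α] in
/-- **`#{r ≤ 3}` is the finset count `#rankLe3`.** -/
theorem ncard_rankLe3_eq (M : Matroid α) [M.Finite] :
    {X : Set α | X ⊆ M.E ∧ M.eRk X ≤ ((3 : ℕ) : ℕ∞)}.ncard = (rankLe3 M).card := by
  classical
  have h : {X : Set α | X ⊆ M.E ∧ M.eRk X ≤ ((3 : ℕ) : ℕ∞)} = {X : Set α | X ⊆ M.E ∧ M.eRk X ≤ 3} := by
    ext X; simp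
  rw [h, ncard_family_eq_card M (fun X => M.eRk X ≤ 3)]
  rfl

omit [DecidableEq α] in
/-- **`2ⁿ ≤ #Y + #{r ≤ 3} + #{spanning}`** when `r(E) = p`: every subset of `E` has rank `≤ 3`, or in `(3, p)`, or
`= p = r(E)`. -/
theorem two_pow_le_ncard_Y_add (M : Matroid α) [M.Finite] (p : ℕ) (hrank : M.eRank = (p : ℕ∞)) :
    2 ^ (gr M).card ≤ {A : Set α | A ⊆ M.E ∧ ((3 : ℕ) : ℕ∞) < M.eRk A ∧ M.eRk A < (p : ℕ∞)}.ncard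
      + {X : Set α | X ⊆ M.E ∧ M.eRk X ≤ ((3 : ℕ) : ℕ∞)}.ncard
      + {X : Set α | X ⊆ M.E ∧ M.eRk X = M.eRank}.ncard := by
  classical
  rw [ncard_family_eq_card M (fun A => ((3 : ℕ) : ℕ∞) < M.eRk A ∧ M.eRk A < (p : ℕ∞)),
    ncard_family_eq_card M (fun X => M.eRk X ≤ ((3 : ℕ) : ℕ∞)),
    ncard_family_eq_card M (fun X => M.eRk X = M.eRank), ← Finset.card_powerset]
  have hsub : (gr M).powerset ⊆
      (gr M).powerset.filter (fun (B : Finset α) => ((3 : ℕ) : ℕ∞) < M.eRk (B : Set α) ∧ M.eRk (B : Set α) < (p : ℕ∞))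
      ∪ (gr M).powerset.filter (fun (B : Finset α) => M.eRk (B : Set α) ≤ ((3 : ℕ) : ℕ∞))
      ∪ (gr M).powerset.filter (fun (B : Finset α) => M.eRk (B : Set α) = M.eRank) := by
    intro S hS
    rw [Finset.mem_union, Finset.mem_union, Finset.mem_filter, Finset.mem_filter, Finset.mem_filter]
    have hle : M.eRk (S : Set α) ≤ (p : ℕ∞) := by rw [← hrank]; exact M.eRk_le_eRank _
    by_cases hp : M.eRk (S : Set α) = (p : ℕ∞)
    · right; exact ⟨hS, by rw [hp, hrank]⟩
    · have hlt : M.eRk (S : Set α) < (p : ℕ∞) := lt_of_le_of_ne hle hp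
      by_cases h3 : M.eRk (S : Set α) ≤ ((3 : ℕ) : ℕ∞)
      · left; right; exact ⟨hS, h3⟩
      · left; left
        push Not at h3
        exact ⟨hS, h3, hlt⟩
  calc (gr M).powerset.card ≤ _ := Finset.card_le_card hsub
    _ ≤ _ := Finset.card_union_le _ _
    _ ≤ _ := by gcongr; exact Finset.card_union_le _ _

omit [DecidableEq α] in
/-- **`Σ_{u ∈ [4, p)} C(n,u) ≤ #Y + #{r ≤ 3}`**: a subset with `4 ≤ |A| < p` has rank `< p`, hence lies in `Y`
unless its rank is `≤ 3`. -/
theorem sum_choose_le_ncard_Y_add (M : Matroid α) [M.Finite] (p : ℕ) :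
    ∑ u ∈ Ico 4 p, Nat.choose (gr M).card u
      ≤ {A : Set α | A ⊆ M.E ∧ ((3 : ℕ) : ℕ∞) < M.eRk A ∧ M.eRk A < (p : ℕ∞)}.ncard
        + {X : Set α | X ⊆ M.E ∧ M.eRk X ≤ ((3 : ℕ) : ℕ∞)}.ncard := by
  classical
  rw [ncard_family_eq_card M (fun A => ((3 : ℕ) : ℕ∞) < M.eRk A ∧ M.eRk A < (p : ℕ∞)),
    ncard_family_eq_card M (fun X => M.eRk X ≤ ((3 : ℕ) : ℕ∞))]
  -- the band `4 ≤ |S| < p`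
  have hband : ((Ico 4 p).biUnion (fun u => powersetCard u (gr M))).card = ∑ u ∈ Ico 4 p, Nat.choose (gr M).card u := by
    rw [Finset.card_biUnion]
    · apply Finset.sum_congr rfl
      intro u _
      exact Finset.card_powersetCard u (gr M)
    · intro i _ j _ hij
      exact Finset.pairwise_disjoint_powersetCard (gr M) hij
  rw [← hband]
  have hsub : (Ico 4 p).biUnion (fun u => powersetCard u (gr M)) ⊆
      (gr M).powerset.filter (fun (B : Finset α) => ((3 : ℕ) : ℕ∞) < M.eRk (B : Set α) ∧ M.eRk (B : Set α) < (p : ℕ∞))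
      ∪ (gr M).powerset.filter (fun (B : Finset α) => M.eRk (B : Set α) ≤ ((3 : ℕ) : ℕ∞)) := by
    intro S hS
    rw [Finset.mem_biUnion] at hS
    obtain ⟨u, hu, hS⟩ := hS
    rw [Finset.mem_Ico] at hu
    rw [Finset.mem_powersetCard] at hS
    rw [Finset.mem_union, Finset.mem_filter, Finset.mem_filter, Finset.mem_powerset]
    have hlt : M.eRk (S : Set α) < (p : ℕ∞) := by
      have h := M.eRk_le_encard (S : Set α)
      rw [Set.encard_coe_eq_coe_finsetCard, hS.2] at h
      exact lt_of_le_of_lt h (by exact_mod_cast hu.2)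
    by_cases h3 : M.eRk (S : Set α) ≤ ((3 : ℕ) : ℕ∞)
    · right; exact ⟨hS.1, h3⟩
    · left
      push Not at h3
      exact ⟨hS.1, h3, hlt⟩
  calc _ ≤ _ := Finset.card_le_card hsub
    _ ≤ _ := Finset.card_union_le _ _

end CoreCount
end PercRepro
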